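import Summits.ValiantsHypothesis.ValiantsHypothesis.Theorems.GrenetZeonDualUnipotentThreeHalvesHeavyTopBorderOrthogonality
import Summits.ValiantsHypothesis.ValiantsHypothesis.Theorems.GrenetZeonDualUnipotentThreeHalvesHeavyTopStrictUpperOfJordan
import Summits.ValiantsHypothesis.ValiantsHypothesis.Theorems.GrenetZeonDualUnipotentThreeHalvesHeavyTopBorderPathCount
import Summits.ValiantsHypothesis.ValiantsHypothesis.Theorems.GrenetZeonDualUnipotentThreeHalvesHeavyTopBorderShift
import Summits.ValiantsHypothesis.ValiantsHypothesis.Theorems.GrenetZeonDualUnipotentThreeHalvesHeavyTopBorderPieces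
import Literature.LinearAlgebra.Matrix.GerstenhaberNilpotentSubspace

/-!
# `GrenetZeon.DualUnipotentThreeHalves` (stmt-ValiantsHypothesis-24318), R2 heavy-top instrument — P-Q1 LEVEL 1 ASSEMBLED:
# a graded border-nilpotent space of dimension `C(s+1,2) − 1` containing the shift is one of the `s` spaces `W⁽ᶜ⁾`

Experiment cell «val-heavytop-census» (D-0160), engine seat val-htc-eng-2 g3 (kernel-only lane; P-Q1 port, eng lineage, R336 (5) / R340 (3)).
Level 1 of the lead's pencil proof `lead-g2/Q1-PROOF.md` §1 (Q1 «ι(7) ≤ 19»; crux `CENSUS-Q1-PROOF.md`), 0-based on `Fin (s+1)`, border `ω = Fin.last s`,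
`A = J_s ⊕ 0` (`A i j = [j = i+1 ∧ j < s]`).  ★ `level_one`: if `W ≤ M_{s+1}(ℂ)` (`s ≥ 3`) is closed under the three border projections
(column `ω`, row `ω`, block), `Z^s = 0` on `W`, `A ∈ W`, `Z_{ω,0} = Z_{s−1,ω} = Z_{ω,ω} = 0` on `W` (envelope), and `finrank W = C(s+1,2) − 1`, then for some
`c ≤ s − 1`: `Z ∈ W ↔` every non-zero entry `(a,b)` of `Z` has `a < b ≠ ω` (block) or `b = ω ∧ a < c` (column) or `a = ω ∧ c < b ≠ ω` (row), i.e.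
`W = W⁽ᶜ⁾ = 𝔫_s ⊕ ⟨E_{iω} : i < c⟩ ⊕ ⟨E_{ωj} : c < j < s⟩`.  Bricks: (L1.a) ✓ `HeavyTopBorderOrthogonality` + eng-1 g3's Krylov triangularity
✓ `HeavyTopBorderShift`; (L1.b) Gerstenhaber ✓ `Literature…finrank_le_choose_two`, window bounds ✓ `HeavyTopBorderPieces`, the count
`C(s+1,2) − 1 ≤ dim col + dim row + dim block`; (L1.c)/(L1.d) eng-1 g3's path counts ✓ `HeavyTopBorderPathCount`; equality cases ✓ `HeavyTopStrictUpperOfJordan`,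
✓ `single_mem_of_finrank_eq_window`.  The instantiation with the graded limit of an actual codimension-one space (✓ `HeavyTopTorusInitial`,
✓ `HeavyTopBorderEnvelope`) is the companion file `…HeavyTopLevelOneSubspace`.  Honest framing: a step of the instrument's kernel port P-Q1; nothing here
proves or refutes `HeavyTopLaw`/`HeavyTopSlowLaw`, 24318, S3 or 8062; `VP ≠ VNP` is NOT proved.  No definitions.
[Q1-PROOF §1 (val-htc-lead g2); bricks by eng-1 g3 and this seat; this seat (assembly)]
-/

noncomputable section

-- single-conjunct layout: Sub = Summit, duplicated namespace component intended
set_option linter.dupNamespace false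

namespace Summit.ValiantsHypothesis.ValiantsHypothesis.Theorems.GrenetZeon.HeavyTopLevelOne

open Matrix
open Literature.LinearAlgebra.Matrix (IsStrictUpper)
open Literature.LinearAlgebra.Matrix.GerstenhaberNilpotentSubspace (finrank_le_choose_two)
open Summit.ValiantsHypothesis.ValiantsHypothesis.Theorems.GrenetZeon.HeavyTopBorderOrthogonality (border_dotProduct_pow_mulVec_eq_zero)
open Summit.ValiantsHypothesis.ValiantsHypothesis.Theorems.GrenetZeon.HeavyTopStrictUpperOfJordan (mem_iff_isStrictUpper_of_shift_mem)
open Summit.ValiantsHypothesis.ValiantsHypothesis.Theorems.GrenetZeon.HeavyTopBorderPathCount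
  (border_single_single_pow_ne_zero border_col_single_pow_ne_zero border_single_row_pow_apply)
open Summit.ValiantsHypothesis.ValiantsHypothesis.Theorems.GrenetZeon.HeavyTopBorderShift (lower_eq_zero_of_dotProduct_shift_pow)
open Summit.ValiantsHypothesis.ValiantsHypothesis.Theorems.GrenetZeon.HeavyTopBorderPieces
  (submatrix_castSucc_pow_eq_zero finrank_le_of_window single_mem_of_finrank_eq_window colP_eq_vecMulVec rowP_eq_vecMulVec
    single_eq_vecMulVec eq_rowP_add_blkP_add_colP)
/-! ## Level 1 -/
/-- ★ **Q1-PROOF Level 1, assembled.**  See the module docstring. [Q1-PROOF §1 (L1.a)–(L1.d)] -/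
theorem level_one {s : ℕ} (hs : 3 ≤ s) (A : Matrix (Fin (s + 1)) (Fin (s + 1)) ℂ)
    (hA : ∀ i j : Fin (s + 1), A i j = if (j : ℕ) = i + 1 ∧ (j : ℕ) < s then 1 else 0)
    (W : Submodule ℂ (Matrix (Fin (s + 1)) (Fin (s + 1)) ℂ))
    (hcolP : ∀ Z ∈ W, (Matrix.of fun a b : Fin (s + 1) => if a ≠ Fin.last s ∧ b = Fin.last s then Z a b else 0) ∈ W)
    (hrowP : ∀ Z ∈ W, (Matrix.of fun a b : Fin (s + 1) => if a = Fin.last s ∧ b ≠ Fin.last s then Z a b else 0) ∈ W)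
    (hblkP : ∀ Z ∈ W, (Matrix.of fun a b : Fin (s + 1) => if a ≠ Fin.last s ∧ b ≠ Fin.last s then Z a b else 0) ∈ W)
    (hpow : ∀ Z ∈ W, Z ^ s = 0) (hAW : A ∈ W)
    (hT0 : ∀ Z ∈ W, Z (Fin.last s) 0 = 0) (hT1 : ∀ Z ∈ W, Z ⟨s - 1, by omega⟩ (Fin.last s) = 0)
    (hTω : ∀ Z ∈ W, Z (Fin.last s) (Fin.last s) = 0)
    (hdim : Module.finrank ℂ W = (s + 1).choose 2 - 1) :
    ∃ c : ℕ, c ≤ s - 1 ∧ ∀ Z : Matrix (Fin (s + 1)) (Fin (s + 1)) ℂ, Z ∈ W ↔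
      ∀ a b : Fin (s + 1), Z a b ≠ 0 →
        (a.val < b.val ∧ b ≠ Fin.last s) ∨ (b = Fin.last s ∧ a.val < c) ∨ (a = Fin.last s ∧ c < b.val ∧ b ≠ Fin.last s) := by
  classical
  set ω : Fin (s + 1) := Fin.last s with hωdef
  have hωv : ω.val = s := by simp [hωdef]
  have hA' : ∀ i j : Fin (s + 1), A i j = if j.val = i.val + 1 ∧ j.val < s then 1 else 0 := hA
  have hArow : ∀ j, A ω j = 0 := fun j => by rw [hA]; exact if_neg (by rw [hωv]; omega)
  have hAcol : ∀ i, A i ω = 0 := fun i => by rw [hA]; exact if_neg (by rw [hωv]; omega)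
  have hnilW : ∀ Z ∈ W, IsNilpotent Z := fun Z hZ => ⟨s, hpow Z hZ⟩
  obtain ⟨colv, hcolv⟩ : ∃ f : Matrix (Fin (s + 1)) (Fin (s + 1)) ℂ →ₗ[ℂ] (Fin (s + 1) → ℂ),
      ∀ Z, f Z = fun i => if i = ω then 0 else Z i ω :=
    ⟨{ toFun := fun Z i => if i = ω then 0 else Z i ω
       map_add' := fun Z Z' => by funext i; by_cases h : i = ω <;> simp [h]
       map_smul' := fun c Z => by funext i; by_cases h : i = ω <;> simp [h] }, fun Z => rfl⟩
  obtain ⟨rowv, hrowv⟩ : ∃ f : Matrix (Fin (s + 1)) (Fin (s + 1)) ℂ →ₗ[ℂ] (Fin (s + 1) → ℂ),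
      ∀ Z, f Z = fun j => if j = ω then 0 else Z ω j :=
    ⟨{ toFun := fun Z j => if j = ω then 0 else Z ω j
       map_add' := fun Z Z' => by funext i; by_cases h : i = ω <;> simp [h]
       map_smul' := fun c Z => by funext i; by_cases h : i = ω <;> simp [h] }, fun Z => rfl⟩
  obtain ⟨blk, hblk⟩ : ∃ f : Matrix (Fin (s + 1)) (Fin (s + 1)) ℂ →ₗ[ℂ] Matrix (Fin s) (Fin s) ℂ,
      ∀ Z, f Z = Z.submatrix Fin.castSucc Fin.castSucc :=
    ⟨{ toFun := fun Z => Z.submatrix Fin.castSucc Fin.castSucc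
       map_add' := fun Z Z' => rfl
       map_smul' := fun c Z => rfl }, fun Z => rfl⟩
  obtain ⟨ecol, hecol⟩ : ∃ e : (Fin (s + 1) → ℂ) →ₗ[ℂ] Matrix (Fin (s + 1)) (Fin (s + 1)) ℂ,
      ∀ u, e u = Matrix.of fun a b : Fin (s + 1) => if a ≠ ω ∧ b = ω then u a else 0 :=
    ⟨{ toFun := fun u => Matrix.of fun a b : Fin (s + 1) => if a ≠ ω ∧ b = ω then u a else 0
       map_add' := fun u v => by ext a b; simp only [Matrix.of_apply, Matrix.add_apply, Pi.add_apply]; split_ifs <;> simp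
       map_smul' := fun c u => by ext a b; simp only [Matrix.of_apply, Matrix.smul_apply, Pi.smul_apply, smul_eq_mul, RingHom.id_apply]; split_ifs <;> simp },
      fun u => rfl⟩
  obtain ⟨erow, herow⟩ : ∃ e : (Fin (s + 1) → ℂ) →ₗ[ℂ] Matrix (Fin (s + 1)) (Fin (s + 1)) ℂ,
      ∀ w, e w = Matrix.of fun a b : Fin (s + 1) => if a = ω ∧ b ≠ ω then w b else 0 :=
    ⟨{ toFun := fun w => Matrix.of fun a b : Fin (s + 1) => if a = ω ∧ b ≠ ω then w b else 0
       map_add' := fun u v => by ext a b; simp only [Matrix.of_apply, Matrix.add_apply, Pi.add_apply]; split_ifs <;> simp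
       map_smul' := fun c u => by ext a b; simp only [Matrix.of_apply, Matrix.smul_apply, Pi.smul_apply, smul_eq_mul, RingHom.id_apply]; split_ifs <;> simp },
      fun w => rfl⟩
  obtain ⟨eblk, heblk⟩ : ∃ e : Matrix (Fin s) (Fin s) ℂ →ₗ[ℂ] Matrix (Fin (s + 1)) (Fin (s + 1)) ℂ,
      ∀ N, e N = Matrix.of fun a b : Fin (s + 1) =>
        if h : a ≠ ω ∧ b ≠ ω then N (a.castPred h.1) (b.castPred h.2) else 0 :=
    ⟨{ toFun := fun N => Matrix.of fun a b : Fin (s + 1) => if h : a ≠ ω ∧ b ≠ ω then N (a.castPred h.1) (b.castPred h.2) else 0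
       map_add' := fun u v => by ext a b; simp only [Matrix.of_apply, Matrix.add_apply]; split_ifs <;> simp
       map_smul' := fun c u => by ext a b; simp only [Matrix.of_apply, Matrix.smul_apply, smul_eq_mul, RingHom.id_apply]; split_ifs <;> simp },
      fun N => rfl⟩
  have colP_eq : ∀ Z, (Matrix.of fun a b : Fin (s + 1) => if a ≠ ω ∧ b = ω then Z a b else 0) = ecol (colv Z) := by
    intro Z; rw [hecol, hcolv]; ext a b; simp only [Matrix.of_apply]
    by_cases ha : a = ω <;> by_cases hb : b = ω <;> simp [ha, hb]
  have rowP_eq : ∀ Z, (Matrix.of fun a b : Fin (s + 1) => if a = ω ∧ b ≠ ω then Z a b else 0) = erow (rowv Z) := by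
    intro Z; rw [herow, hrowv]; ext a b; simp only [Matrix.of_apply]
    by_cases ha : a = ω <;> by_cases hb : b = ω <;> simp [ha, hb]
  have blkP_eq : ∀ Z, (Matrix.of fun a b : Fin (s + 1) => if a ≠ ω ∧ b ≠ ω then Z a b else 0) = eblk (blk Z) := by
    intro Z; rw [heblk, hblk]; ext a b; simp only [Matrix.of_apply, Matrix.submatrix_apply, Fin.castSucc_castPred]
    by_cases h : a ≠ ω ∧ b ≠ ω
    · rw [if_pos h, dif_pos h]
    · rw [if_neg h, dif_neg h]
  set C := W.map colv with hC
  set R := W.map rowv with hR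
  set B := W.map blk with hB
  have memC : ∀ Z ∈ W, colv Z ∈ C := fun Z hZ => Submodule.mem_map_of_mem hZ
  have memR : ∀ Z ∈ W, rowv Z ∈ R := fun Z hZ => Submodule.mem_map_of_mem hZ
  have memB : ∀ Z ∈ W, blk Z ∈ B := fun Z hZ => Submodule.mem_map_of_mem hZ
  have hcount : Module.finrank ℂ W ≤ Module.finrank ℂ C + Module.finrank ℂ R + Module.finrank ℂ B := by
    have hle : W ≤ (R.map erow ⊔ B.map eblk) ⊔ C.map ecol := by
      intro Z hZ
      have e := eq_rowP_add_blkP_add_colP Z (hTω Z hZ)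
      rw [rowP_eq, blkP_eq, colP_eq] at e
      rw [e]
      refine Submodule.add_mem _ (Submodule.add_mem _ ?_ ?_) ?_
      · exact Submodule.mem_sup_left (Submodule.mem_sup_left (Submodule.mem_map_of_mem (memR Z hZ)))
      · exact Submodule.mem_sup_left (Submodule.mem_sup_right (Submodule.mem_map_of_mem (memB Z hZ)))
      · exact Submodule.mem_sup_right (Submodule.mem_map_of_mem (memC Z hZ))
    calc Module.finrank ℂ W ≤ Module.finrank ℂ ((R.map erow ⊔ B.map eblk) ⊔ C.map ecol : Submodule ℂ _) :=
          Submodule.finrank_mono hle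
      _ ≤ Module.finrank ℂ (R.map erow ⊔ B.map eblk : Submodule ℂ _) + Module.finrank ℂ (C.map ecol) :=
          Submodule.finrank_add_le_finrank_add_finrank _ _
      _ ≤ (Module.finrank ℂ (R.map erow) + Module.finrank ℂ (B.map eblk)) + Module.finrank ℂ (C.map ecol) := by
          gcongr; exact Submodule.finrank_add_le_finrank_add_finrank _ _
      _ ≤ (Module.finrank ℂ R + Module.finrank ℂ B) + Module.finrank ℂ C := by
          gcongr <;> exact Submodule.finrank_map_le _ _
      _ = _ := by ring
  set S : Finset (Fin (s + 1)) := Finset.univ.filter (fun i => i ≠ ω ∧ ∃ Z ∈ W, Z i ω ≠ 0) with hSdef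
  set t₀ : ℕ := if h : S.Nonempty then (S.max' h).val + 1 else 0 with ht₀def
  have hSmem : ∀ i, i ∈ S ↔ (i ≠ ω ∧ ∃ Z ∈ W, Z i ω ≠ 0) := fun i => by rw [hSdef, Finset.mem_filter]; simp
  have t0a : ∀ Z ∈ W, ∀ i : Fin (s + 1), i ≠ ω → t₀ ≤ i.val → Z i ω = 0 := by
    intro Z hZ i hi hti
    by_contra hne
    have hiS : i ∈ S := (hSmem i).2 ⟨hi, Z, hZ, hne⟩
    have hne' : S.Nonempty := ⟨i, hiS⟩
    have hmax := S.le_max' i hiS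
    rw [ht₀def, dif_pos hne'] at hti
    have : (S.max' hne').val < i.val := by omega
    exact absurd (Fin.lt_def.2 this) (not_lt.2 hmax)
  have t0c : t₀ ≤ s - 1 := by
    by_cases hne : S.Nonempty
    · obtain ⟨hiω, Z, hZ, hZne⟩ := (hSmem _).1 (S.max'_mem hne)
      have h1 : (S.max' hne).val ≠ s - 1 := by
        intro h
        have e : S.max' hne = ⟨s - 1, by omega⟩ := Fin.ext h
        exact hZne (by rw [e]; exact hT1 Z hZ)
      have h2 : (S.max' hne).val < s := by
        have := (S.max' hne).isLt
        have h3 : (S.max' hne).val ≠ s := fun h => hiω (Fin.ext (by rw [h, hωv]))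
        omega
      rw [ht₀def, dif_pos hne]; omega
    · rw [ht₀def, dif_neg hne]; omega
  have t0b : 1 ≤ t₀ → ∃ Z ∈ W, Z ⟨t₀ - 1, by omega⟩ ω ≠ 0 := by
    intro h1
    have hne : S.Nonempty := by by_contra hne; rw [ht₀def, dif_neg hne] at h1; omega
    obtain ⟨-, Z, hZ, hZne⟩ := (hSmem _).1 (S.max'_mem hne)
    refine ⟨Z, hZ, ?_⟩
    have ht : t₀ = (S.max' hne).val + 1 := by rw [ht₀def, dif_pos hne]
    have e : (⟨t₀ - 1, by omega⟩ : Fin (s + 1)) = S.max' hne := Fin.ext (show t₀ - 1 = (S.max' hne).val by omega)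
    rw [e]; exact hZne
  have hCsupp : ∀ u ∈ C, ∀ i : Fin (s + 1), (i.val < 0 ∨ t₀ ≤ i.val) → u i = 0 := by
    rintro u ⟨Z, hZ, rfl⟩ i hi
    rcases hi with hi | hi
    · omega
    · rw [hcolv]
      by_cases hiω : i = ω
      · simp [hiω]
      · simp only [hiω, if_false]; exact t0a Z hZ i hiω hi
  have hfC : Module.finrank ℂ C ≤ t₀ := by simpa using finrank_le_of_window C 0 t₀ (by omega) hCsupp
  have hU : 1 ≤ t₀ → ∃ u₁ : Fin (s + 1) → ℂ, vecMulVec u₁ (Pi.single ω (1 : ℂ)) ∈ W ∧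
      (∀ i : Fin (s + 1), t₀ ≤ i.val → u₁ i = 0) ∧ u₁ ⟨t₀ - 1, by omega⟩ ≠ 0 := by
    intro h1
    obtain ⟨Z₁, hZ₁, hZ₁ne⟩ := t0b h1
    refine ⟨fun i => if i = ω then 0 else Z₁ i ω, ?_, fun i hi => ?_, ?_⟩
    · rw [← colP_eq_vecMulVec Z₁]; exact hcolP Z₁ hZ₁
    · by_cases hiω : i = ω
      · simp [hiω]
      · simp only [hiω, if_false]; exact t0a Z₁ hZ₁ i hiω hi
    · have hne : (⟨t₀ - 1, by omega⟩ : Fin (s + 1)) ≠ ω := fun e => by rw [Fin.ext_iff, hωv] at e; simp at e; omega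
      simp only [hne, if_false]; exact hZ₁ne
  have hKry : ∀ Z ∈ W, ∀ j : Fin (s + 1), j.val < t₀ → Z ω j = 0 := by
    intro Z₂ hZ₂ j hj
    have h1 : 1 ≤ t₀ := by omega
    obtain ⟨u₁, hu₁W, hu₁s, hu₁t⟩ := hU h1
    set w : Fin (s + 1) → ℂ := fun j => if j = ω then 0 else Z₂ ω j with hw
    have horth : ∀ k : ℕ, w ⬝ᵥ (A ^ k *ᵥ u₁) = 0 := by
      intro k
      refine border_dotProduct_pow_mulVec_eq_zero A u₁ w hArow hAcol (by simp [hw, hωdef]) (fun y => hnilW _ ?_) k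
      rw [← rowP_eq_vecMulVec Z₂]
      exact W.add_mem (W.add_mem hAW (hrowP Z₂ hZ₂)) (W.smul_mem y hu₁W)
    have h := lower_eq_zero_of_dotProduct_shift_pow A hA h1 (by omega) u₁ w hu₁s hu₁t horth j hj
    have hjω : j ≠ ω := fun e => by rw [e, hωv] at hj; omega
    simpa [hw, hjω] using h
  have hRsupp : ∀ w ∈ R, ∀ j : Fin (s + 1), (j.val < max t₀ 1 ∨ s ≤ j.val) → w j = 0 := by
    rintro w ⟨Z, hZ, rfl⟩ j hj
    rw [hrowv]
    by_cases hjω : j = ω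
    · simp [hjω]
    · simp only [hjω, if_false]
      rcases hj with hj | hj
      · by_cases hj0 : j.val = 0
        · have e : j = 0 := Fin.ext (by rw [hj0]; simp)
          rw [e]; exact hT0 Z hZ
        · exact hKry Z hZ j (by omega)
      · exact absurd (Fin.ext (by rw [hωv]; have := j.isLt; omega)) hjω
  have hfR : Module.finrank ℂ R ≤ s - max t₀ 1 := finrank_le_of_window R (max t₀ 1) s (by omega) hRsupp
  have hBnil : ∀ N ∈ B, IsNilpotent N := by
    rintro N ⟨Z, hZ, rfl⟩
    refine ⟨s, ?_⟩
    rw [hblk]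
    have e : Z.submatrix Fin.castSucc Fin.castSucc =
        (Matrix.of fun a b : Fin (s + 1) => if a ≠ ω ∧ b ≠ ω then Z a b else 0).submatrix Fin.castSucc Fin.castSucc := by
      ext i j
      simp [Matrix.submatrix_apply, hωdef, Fin.castSucc_ne_last]
    rw [e]
    exact submatrix_castSucc_pow_eq_zero _ (fun b => by simp [hωdef]) (hpow _ (hblkP Z hZ))
  have hfB : Module.finrank ℂ B ≤ s.choose 2 := finrank_le_choose_two s B hBnil
  have hJB : (Matrix.of fun a b : Fin s => if b.val = a.val + 1 then (1 : ℂ) else 0) ∈ B := by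
    have e : blk A = Matrix.of fun a b : Fin s => if b.val = a.val + 1 then (1 : ℂ) else 0 := by
      rw [hblk]; ext a b
      simp only [Matrix.submatrix_apply, Matrix.of_apply, hA, Fin.val_castSucc]
      by_cases h : b.val = a.val + 1
      · rw [if_pos ⟨h, b.isLt⟩, if_pos h]
      · rw [if_neg (fun h' => h h'.1), if_neg h]
    rw [← e]; exact memB A hAW
  have hchoose : (s + 1).choose 2 = s + s.choose 2 := by rw [Nat.choose_succ_succ, Nat.choose_one_right]
  have hcount' : s.choose 2 + s - 1 ≤ Module.finrank ℂ C + Module.finrank ℂ R + Module.finrank ℂ B := by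
    have h := hcount; rw [hdim, hchoose] at h; omega
  have fullC : Module.finrank ℂ C = t₀ → ∀ i : Fin (s + 1), i.val < t₀ → Matrix.single i ω (1 : ℂ) ∈ W := by
    intro hfull i hi
    have hmem := single_mem_of_finrank_eq_window C 0 t₀ (by omega) hCsupp (by simpa using hfull) i (by omega) hi
    obtain ⟨Z, hZ, hZe⟩ := hmem
    have e : (Matrix.of fun a b : Fin (s + 1) => if a ≠ ω ∧ b = ω then Z a b else 0) = Matrix.single i ω 1 := by
      rw [colP_eq_vecMulVec, single_eq_vecMulVec, ← hcolv, hZe]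
    rw [← e]; exact hcolP Z hZ
  have fullR : ∀ lo : ℕ, (∀ w ∈ R, ∀ j : Fin (s + 1), (j.val < lo ∨ s ≤ j.val) → w j = 0) → Module.finrank ℂ R = s - lo →
      ∀ j : Fin (s + 1), lo ≤ j.val → j.val < s → Matrix.single ω j (1 : ℂ) ∈ W := by
    intro lo hsupp hfull j hlo hjs
    have hmem := single_mem_of_finrank_eq_window R lo s (by omega) hsupp hfull j hlo hjs
    obtain ⟨Z, hZ, hZe⟩ := hmem
    have e : (Matrix.of fun a b : Fin (s + 1) => if a = ω ∧ b ≠ ω then Z a b else 0) = Matrix.single ω j 1 := by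
      rw [rowP_eq_vecMulVec, single_eq_vecMulVec, ← hrowv, hZe]
    rw [← e]; exact hrowP Z hZ
  have fullB : Module.finrank ℂ B = s.choose 2 →
      (∀ Z ∈ W, ∀ a b : Fin (s + 1), a ≠ ω → b ≠ ω → b.val ≤ a.val → Z a b = 0) ∧
      (∀ a b : Fin (s + 1), a.val < b.val → b ≠ ω → Matrix.single a b (1 : ℂ) ∈ W) := by
    intro hfull
    have key := mem_iff_isStrictUpper_of_shift_mem B hBnil hfull hJB
    constructor
    · intro Z hZ a b ha hb hba
      have hsu : IsStrictUpper (blk Z) := (key _).1 (memB Z hZ)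
      have h := hsu (a.castPred ha) (b.castPred hb) (by rw [Fin.le_def]; simp; exact hba)
      rw [hblk] at h
      simpa [Matrix.submatrix_apply, Fin.castSucc_castPred] using h
    · intro a b hab hb
      have ha : a ≠ ω := fun e => by rw [e, hωv] at hab; have := b.isLt; omega
      have hsu : IsStrictUpper (Matrix.single (a.castPred ha) (b.castPred hb) (1 : ℂ)) := by
        intro i j hji
        apply Matrix.single_apply_of_ne
        rintro ⟨hi, hj⟩
        rw [← hi, ← hj, Fin.le_def] at hji
        simp at hji; omega
      obtain ⟨Z, hZ, hZe⟩ := (key _).2 hsu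
      have e : (Matrix.of fun x y : Fin (s + 1) => if x ≠ ω ∧ y ≠ ω then Z x y else 0) = Matrix.single a b 1 := by
        ext x y
        simp only [Matrix.of_apply]
        by_cases h : x ≠ ω ∧ y ≠ ω
        · rw [if_pos h]
          have e1 := congr_fun (congr_fun hZe (x.castPred h.1)) (y.castPred h.2)
          rw [hblk] at e1
          simp only [Matrix.submatrix_apply, Fin.castSucc_castPred] at e1
          rw [e1]
          by_cases hxy : x = a ∧ y = b
          · obtain ⟨rfl, rfl⟩ := hxy; simp
          · rw [Matrix.single_apply_of_ne (h := fun h' => hxy ⟨h'.1.symm, h'.2.symm⟩),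
              Matrix.single_apply_of_ne]
            rintro ⟨h1, h2⟩
            exact hxy ⟨by rw [← Fin.castSucc_castPred x h.1, ← h1, Fin.castSucc_castPred],
              by rw [← Fin.castSucc_castPred y h.2, ← h2, Fin.castSucc_castPred]⟩
        · rw [if_neg h, Matrix.single_apply_of_ne]
          rintro ⟨rfl, rfl⟩
          exact h ⟨ha, hb⟩
      rw [← e]; exact hblkP Z hZ
  have ht1s : t₀ + 1 ≤ s := by omega
  have main : Module.finrank ℂ B = s.choose 2 ∧ Module.finrank ℂ C = t₀ ∧
      (∀ Z ∈ W, ∀ j : Fin (s + 1), j ≠ ω → j.val ≤ t₀ → Z ω j = 0) ∧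
      (∀ j : Fin (s + 1), t₀ < j.val → j.val < s → Matrix.single ω j (1 : ℂ) ∈ W) := by
    by_cases ht : t₀ = 0
    · -- no column at all
      have hmax : max t₀ 1 = 1 := by rw [ht]; simp
      rw [hmax] at hfR hRsupp
      have hB' : Module.finrank ℂ B = s.choose 2 := by omega
      have hR' : Module.finrank ℂ R = s - 1 := by omega
      refine ⟨hB', by omega, ?_, ?_⟩
      · intro Z hZ j hj hjt
        have e : j = 0 := by apply Fin.ext; rw [Fin.val_zero]; omega
        rw [e]; exact hT0 Z hZ
      · intro j hj hjs
        exact fullR 1 hRsupp hR' j (by omega) hjs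
    · have h1 : 1 ≤ t₀ := by omega
      have hmax : max t₀ 1 = t₀ := max_eq_left h1
      rw [hmax] at hfR hRsupp
      have hB' : Module.finrank ℂ B = s.choose 2 := by
        by_contra hB'
        have hC' : Module.finrank ℂ C = t₀ := by omega
        have hR' : Module.finrank ℂ R = s - t₀ := by omega
        have m1 := fullC hC' ⟨t₀ - 1, by omega⟩ (by simp; omega)
        have m2 := fullR t₀ hRsupp hR' ⟨t₀, by omega⟩ (by simp) (by simp; omega)
        have hmem : A + Matrix.single ω ⟨t₀, by omega⟩ 1 + Matrix.single ⟨t₀ - 1, by omega⟩ ω 1 ∈ W :=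
          W.add_mem (W.add_mem hAW m2) m1
        have hne := border_single_single_pow_ne_zero h1 ht1s A hA
        rw [← single_eq_vecMulVec, ← single_eq_vecMulVec] at hne
        exact hne (hpow _ hmem)
      have hC' : Module.finrank ℂ C = t₀ := by
        by_contra hC'
        have hR' : Module.finrank ℂ R = s - t₀ := by omega
        have m2 := fullR t₀ hRsupp hR' ⟨t₀, by omega⟩ (by simp) (by simp; omega)
        obtain ⟨u₁, hu₁W, hu₁s, hu₁t⟩ := hU h1
        have hmem : A + Matrix.single ω ⟨t₀, by omega⟩ 1 + vecMulVec u₁ (Pi.single ω 1) ∈ W :=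
          W.add_mem (W.add_mem hAW m2) hu₁W
        have hne := border_col_single_pow_ne_zero h1 ht1s A hA u₁ hu₁s hu₁t
        rw [← single_eq_vecMulVec] at hne
        exact hne (hpow _ hmem)
      have hrowt : ∀ Z ∈ W, ∀ j : Fin (s + 1), j ≠ ω → j.val ≤ t₀ → Z ω j = 0 := by
        intro Z₂ hZ₂ j hjω hjt
        rcases Nat.lt_or_ge j.val t₀ with hlt | hge
        · exact hKry Z₂ hZ₂ j hlt
        · have hjt' : j.val = t₀ := by omega
          by_cases hts : t₀ + 1 ≤ s
          · have m1 := fullC hC' ⟨t₀ - 1, by omega⟩ (by simp; omega)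
            set w : Fin (s + 1) → ℂ := fun j => if j = ω then 0 else Z₂ ω j with hw
            have hws : ∀ j : Fin (s + 1), j.val < t₀ → w j = 0 := by
              intro j' hj'
              have hj'ω : j' ≠ ω := fun e => by rw [e, hωv] at hj'; omega
              simp only [hw, hj'ω, if_false]; exact hKry Z₂ hZ₂ j' hj'
            have hmem : A + vecMulVec (Pi.single ω 1) w + Matrix.single ⟨t₀ - 1, by omega⟩ ω 1 ∈ W := by
              refine W.add_mem (W.add_mem hAW ?_) m1
              rw [hw, ← rowP_eq_vecMulVec]; exact hrowP Z₂ hZ₂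
            have h := border_single_row_pow_apply h1 hts A hA w hws (by simp [hw, hωdef])
            rw [← single_eq_vecMulVec, hpow _ hmem, Matrix.zero_apply] at h
            have e : j = ⟨t₀, by omega⟩ := Fin.ext hjt'
            have h' : w j = 0 := by rw [e]; exact h.symm
            simpa [hw, hjω] using h'
          · exfalso; omega
      have hRsupp' : ∀ w ∈ R, ∀ j : Fin (s + 1), (j.val < t₀ + 1 ∨ s ≤ j.val) → w j = 0 := by
        rintro w ⟨Z, hZ, rfl⟩ j hj
        rw [hrowv]
        by_cases hjω : j = ω
        · simp [hjω]
        · simp only [hjω, if_false]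
          rcases hj with hj | hj
          · exact hrowt Z hZ j hjω (by omega)
          · exact absurd (Fin.ext (by rw [hωv]; have := j.isLt; omega)) hjω
      have hfR' : Module.finrank ℂ R ≤ s - (t₀ + 1) := finrank_le_of_window R (t₀ + 1) s (by omega) hRsupp'
      have hR' : Module.finrank ℂ R = s - (t₀ + 1) := by omega
      refine ⟨hB', hC', hrowt, fun j hj hjs => fullR (t₀ + 1) hRsupp' hR' j (by omega) hjs⟩
  obtain ⟨hBfull, hCfull, hrows, hrowunits⟩ := main
  obtain ⟨hblock0, hblockunits⟩ := fullB hBfull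
  refine ⟨t₀, t0c, fun Z => ⟨fun hZ a b hab => ?_, fun hshape => ?_⟩⟩
  · by_cases ha : a = ω <;> by_cases hb : b = ω
    · exact absurd (by rw [ha, hb]; exact hTω Z hZ) hab
    · right; right
      refine ⟨ha, ?_, hb⟩
      by_contra hle
      exact hab (by rw [ha]; exact hrows Z hZ b hb (by omega))
    · right; left
      refine ⟨hb, ?_⟩
      by_contra hle
      exact hab (by rw [hb]; exact t0a Z hZ a ha (by omega))
    · left
      refine ⟨?_, hb⟩
      by_contra hle
      exact hab (hblock0 Z hZ a b ha hb (by omega))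
  · rw [Matrix.matrix_eq_sum_single Z]
    refine W.sum_mem fun a _ => W.sum_mem fun b _ => ?_
    by_cases hab : Z a b = 0
    · rw [hab]; simp
    · have e : Matrix.single a b (Z a b) = Z a b • Matrix.single a b (1 : ℂ) := by
        rw [Matrix.smul_single, smul_eq_mul, mul_one]
      rw [e]
      refine W.smul_mem _ ?_
      rcases hshape a b hab with ⟨h1, h2⟩ | ⟨h1, h2⟩ | ⟨h1, h2, h3⟩
      · exact hblockunits a b h1 h2
      · rw [h1]; exact fullC hCfull a h2
      · have h3' : b.val ≠ s := fun e => h3 (Fin.ext (by rw [hωv]; exact e))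
        have := b.isLt
        rw [h1]; exact hrowunits b h2 (by omega)

end Summit.ValiantsHypothesis.ValiantsHypothesis.Theorems.GrenetZeon.HeavyTopLevelOne

end
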